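import Summits.Ventures.PercRepro.S1CFGTrianglesTwo
import Summits.Ventures.PercRepro.S1CFGFourCircuits

/-!
# PercRepro — BASE LEMMAS FOR THE DEPENDENT-`4`-SET CAP (p1, gen 40)

`D₄(S) := #{X ⊆ S : |X| = 4, rk X ≤ 3}` (the dependent `4`-sets of a simple matroid), `c₃(S)` the rank-`2` triples.
This file: the generic pieces of the cap `D₄ ≤ C(ν + 1, 4) + (n − ν − 1)·C(ν + 1, 3) + C(ν + 1, 2) + (n − 3)`
(S1CFGDepFour) that do not mention the series class:
* `ncard_subsets_eq_choose` — a finite set has `C(|S|, k)` subsets of size `k`; `ncard_four_eRk_le_three_le_choose`: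
  `D₄(S) ≤ C(|S|, 4)`;
* `dep_of_ncard_eq_four_of_eRk_le_three`, `three_le_ncard_of_isCircuit`, `eRk_le_two_of_isCircuit_ncard_three`;
* the RESTRICTION PACKAGE `restrict_hd / restrict_hK / restrict_h0 / restrict_count_three / restrict_count_four`:
  `M ↾ S` for `S ⊆ E` is finite, has the nullity of `S`, is coloop-free when every point of `S` lies in the
  closure of the rest of `S`, is simple, and its counts are `M`'s counts over `S`;
* `mul_ncard_four_eRk_le_three_le` — the averaging double count `(n − 4)·D₄ ≤ n·B` when every `E ∖ {e}` carries
  at most `B` dependent `4`-sets.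
Nothing about any cell is claimed. Axioms: standard.
-/

open scoped Matroid

namespace PercRepro

namespace S1CFG

open Set S1CF

variable {α : Type}

/-- A finite set `S` has exactly `C(|S|, k)` subsets of size `k`. -/
theorem ncard_subsets_eq_choose {S : Set α} (hS : S.Finite) (k : ℕ) :
    {X : Set α | X ⊆ S ∧ X.ncard = k}.ncard = S.ncard.choose k := by
  classical
  have himg : {X : Set α | X ⊆ S ∧ X.ncard = k} =
      (fun s : Finset α => (s : Set α)) '' ((hS.toFinset.powersetCard k : Finset (Finset α)) : Set (Finset α)) := by
    ext X
    simp only [Set.mem_setOf_eq, Set.mem_image, Finset.mem_coe, Finset.mem_powersetCard]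
    constructor
    · rintro ⟨hXS, hXk⟩
      have hXfin : X.Finite := hS.subset hXS
      refine ⟨hXfin.toFinset, ⟨?_, ?_⟩, by simp⟩
      · intro x hx
        rw [Set.Finite.mem_toFinset] at hx ⊢
        exact hXS hx
      · rw [← hXk, Set.ncard_eq_toFinset_card X hXfin]
    · rintro ⟨s, ⟨hsS, hsk⟩, rfl⟩
      refine ⟨fun x hx => ?_, ?_⟩
      · have := hsS (Finset.mem_coe.mp hx)
        rwa [Set.Finite.mem_toFinset] at this
      · rw [Set.ncard_coe_finset, hsk]
  rw [himg, Set.ncard_image_of_injective _ Finset.coe_injective, Set.ncard_coe_finset,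
    Finset.card_powersetCard, Set.ncard_eq_toFinset_card S hS]

/-- `D₄(S) ≤ C(|S|, 4)`: the dependent `4`-sets are among all `4`-subsets. -/
theorem ncard_four_eRk_le_three_le_choose (M : Matroid α) [M.Finite] {S : Set α} (hS : S ⊆ M.E) :
    {X : Set α | X ⊆ S ∧ X.ncard = 4 ∧ M.eRk X ≤ 3}.ncard ≤ S.ncard.choose 4 := by
  have hSfin : S.Finite := M.ground_finite.subset hS
  rw [← ncard_subsets_eq_choose hSfin 4]
  exact Set.ncard_le_ncard (fun X hX => ⟨hX.1, hX.2.1⟩) (hSfin.finite_subsets.subset (fun X hX => hX.1))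

/-- A `4`-set of rank `≤ 3` is dependent. -/
theorem dep_of_ncard_eq_four_of_eRk_le_three (M : Matroid α) [M.Finite] {X : Set α} (hX : X ⊆ M.E)
    (h4 : X.ncard = 4) (hr : M.eRk X ≤ 3) : M.Dep X := by
  rw [Matroid.Dep, and_iff_left hX]
  intro hind
  have hXfin : X.Finite := M.ground_finite.subset hX
  rw [hind.eRk_eq_encard, ← hXfin.cast_ncard_eq, h4] at hr
  exact absurd hr (by decide)

/-- In a matroid with no dependent pair and at least two points, every circuit has at least `3` elements. -/
theorem three_le_ncard_of_isCircuit (M : Matroid α) [M.Finite]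
    (h0 : {P : Set α | P ⊆ M.E ∧ P.ncard = 2 ∧ M.Dep P}.ncard = 0) (hn : 2 ≤ M.E.ncard) {C : Set α}
    (hC : M.IsCircuit C) : 3 ≤ C.ncard := by
  have hEfin := M.ground_finite
  have hCE : C ⊆ M.E := hC.subset_ground
  have hCfin : C.Finite := hEfin.subset hCE
  by_contra hlt
  push Not at hlt
  -- extend `C` to a pair `P ⊆ E`
  obtain ⟨P, hCP, hPE, hP2⟩ : ∃ P : Set α, C ⊆ P ∧ P ⊆ M.E ∧ P.ncard = 2 := by
    obtain ⟨P, hCP, hPE, hP2⟩ := Set.exists_subsuperset_card_eq hCE (show C.ncard ≤ 2 by omega) (by omega)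
    exact ⟨P, hCP, hPE, hP2⟩
  have hPdep : M.Dep P := hC.dep.superset hCP hPE
  have hPmem : P ∈ {P : Set α | P ⊆ M.E ∧ P.ncard = 2 ∧ M.Dep P} := ⟨hPE, hP2, hPdep⟩
  have hfam : {P : Set α | P ⊆ M.E ∧ P.ncard = 2 ∧ M.Dep P}.Finite :=
    hEfin.finite_subsets.subset (fun P hP => hP.1)
  rw [Set.ncard_eq_zero hfam] at h0
  rw [h0] at hPmem
  exact hPmem

/-- A `3`-circuit has rank `2`. -/
theorem eRk_le_two_of_isCircuit_ncard_three (M : Matroid α) [M.Finite] {C : Set α} (hC : M.IsCircuit C)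
    (h3 : C.ncard = 3) : M.eRk C ≤ 2 := by
  have hCfin : C.Finite := M.ground_finite.subset hC.subset_ground
  have h := hC.eRk_add_one_eq
  rw [← hCfin.cast_ncard_eq, h3] at h
  have hfin : M.eRk C ≠ ⊤ := ((M.eRk_le_encard C).trans_lt hCfin.encard_lt_top).ne
  obtain ⟨r, hr⟩ : ∃ r : ℕ, M.eRk C = r := ⟨_, (ENat.coe_toNat hfin).symm⟩
  rw [hr] at h ⊢
  have : r + 1 = 3 := by exact_mod_cast h
  exact_mod_cast (show r ≤ 2 by omega)

/-! ### The restriction package -/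

/-- The restriction `M ↾ S` has the nullity of `S`: `|S| = rk S + ν'` read as `(M ↾ S).E.encard = eRank + ν'`. -/
theorem restrict_hd (M : Matroid α) [M.Finite] {S : Set α} (hS : S ⊆ M.E) {ν' : ℕ}
    (hν' : S.ncard = (M.eRk S).toNat + ν') :
    (M ↾ S).E.encard = (M ↾ S).eRank + (ν' : ℕ∞) := by
  have hSfin : S.Finite := M.ground_finite.subset hS
  rw [Matroid.restrict_ground_eq, Matroid.eRank_restrict, ← S1.coe_toNat_eRk M hS, ← hSfin.cast_ncard_eq,
    ← Nat.cast_add, hν']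

/-- The restriction `M ↾ S` is coloop-free when every point of `S` lies in the closure of the rest of `S`. -/
theorem restrict_hK (M : Matroid α) [M.Finite] {S : Set α} (hS : S ⊆ M.E)
    (hcl : ∀ x ∈ S, x ∈ M.closure (S \ {x})) : ∀ x, ¬ (M ↾ S).IsColoop x := by
  intro x hx
  rw [Matroid.restrict_isColoop_iff hS] at hx
  exact hx.1 (hcl x hx.2)

/-- The restriction `M ↾ S` of a matroid with no dependent pair has no dependent pair. -/
theorem restrict_h0 (M : Matroid α) [M.Finite] {S : Set α} (hS : S ⊆ M.E)
    (h0 : {P : Set α | P ⊆ M.E ∧ P.ncard = 2 ∧ M.Dep P}.ncard = 0) :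
    {P : Set α | P ⊆ (M ↾ S).E ∧ P.ncard = 2 ∧ (M ↾ S).Dep P}.ncard = 0 := by
  have hSfin : S.Finite := M.ground_finite.subset hS
  rw [Set.ncard_eq_zero (hSfin.finite_subsets.subset (fun P hP => hP.1))]
  rw [Set.eq_empty_iff_forall_notMem]
  intro P hP
  obtain ⟨hPS, hP2, hPdep⟩ := hP
  rw [Matroid.restrict_ground_eq] at hPS
  rw [Matroid.restrict_dep_iff] at hPdep
  have hPind := indep_of_ncard_eq_two_of_no_dep_pair M h0 (hPS.trans hS) hP2
  exact hPdep.1 hPind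

/-- The rank-`2` triples of `M ↾ S` are the rank-`2` triples of `M` inside `S`. -/
theorem restrict_count_three (M : Matroid α) [M.Finite] (S : Set α) :
    {X : Set α | X ⊆ (M ↾ S).E ∧ X.ncard = 3 ∧ (M ↾ S).eRk X ≤ 2} =
      {X : Set α | X ⊆ S ∧ X.ncard = 3 ∧ M.eRk X ≤ 2} := by
  ext X
  simp only [Set.mem_setOf_eq, Matroid.restrict_ground_eq]
  constructor
  · rintro ⟨hXS, hX3, hXr⟩
    rw [Matroid.restrict_eRk_eq M hXS] at hXr
    exact ⟨hXS, hX3, hXr⟩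
  · rintro ⟨hXS, hX3, hXr⟩
    rw [Matroid.restrict_eRk_eq M hXS]
    exact ⟨hXS, hX3, hXr⟩

/-- The dependent `4`-sets of `M ↾ S` are the dependent `4`-sets of `M` inside `S`. -/
theorem restrict_count_four (M : Matroid α) [M.Finite] (S : Set α) :
    {X : Set α | X ⊆ (M ↾ S).E ∧ X.ncard = 4 ∧ (M ↾ S).eRk X ≤ 3} =
      {X : Set α | X ⊆ S ∧ X.ncard = 4 ∧ M.eRk X ≤ 3} := by
  ext X
  simp only [Set.mem_setOf_eq, Matroid.restrict_ground_eq]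
  constructor
  · rintro ⟨hXS, hX4, hXr⟩
    rw [Matroid.restrict_eRk_eq M hXS] at hXr
    exact ⟨hXS, hX4, hXr⟩
  · rintro ⟨hXS, hX4, hXr⟩
    rw [Matroid.restrict_eRk_eq M hXS]
    exact ⟨hXS, hX4, hXr⟩

/-- `E ∖ {e}` (`e` not a coloop) has nullity `ν − 1`, in the natural-number form of `restrict_hd`. -/
theorem ncard_sdiff_singleton_eq_eRk_toNat_add (M : Matroid α) [M.Finite] {ν : ℕ}
    (hd : M.E.encard = M.eRank + (ν : ℕ∞)) (hK : ∀ e, ¬ M.IsColoop e) {e : α} (he : e ∈ M.E) (hν : 1 ≤ ν) :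
    (M.E \ {e}).ncard = (M.eRk (M.E \ {e})).toNat + (ν - 1) := by
  have hrk : M.eRk (M.E \ {e}) = M.eRk M.E := eRk_sdiff_singleton_eq_of_not_isColoop M he (hK e)
  have hnE := ncard_ground_eq_eRk_toNat_add M hd
  have hcard : (M.E \ {e}).ncard = M.E.ncard - 1 := Set.ncard_sdiff_singleton_of_mem he
  rw [hrk]
  omega

/-- **THE AVERAGING DOUBLE COUNT FOR `D₄`**: if every `E ∖ {e}` carries at most `B` dependent `4`-sets then
`(n − 4)·D₄ ≤ n·B` (every dependent `4`-set is avoided by exactly `n − 4` points). -/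
theorem mul_ncard_four_eRk_le_three_le (M : Matroid α) [M.Finite] {B : ℕ}
    (hB : ∀ e ∈ M.E, {X : Set α | X ⊆ M.E \ {e} ∧ X.ncard = 4 ∧ M.eRk X ≤ 3}.ncard ≤ B) :
    (M.E.ncard - 4) * {X : Set α | X ⊆ M.E ∧ X.ncard = 4 ∧ M.eRk X ≤ 3}.ncard ≤ M.E.ncard * B := by
  classical
  have hEfin := M.ground_finite
  set E' := hEfin.toFinset with hE'
  have hmemE' : ∀ x, x ∈ E' ↔ x ∈ M.E := fun x => Set.Finite.mem_toFinset hEfin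
  have hcardE' : E'.card = M.E.ncard := (Set.ncard_eq_toFinset_card M.E hEfin).symm
  set 𝒟 := (E'.powersetCard 4).filter (fun X : Finset α => M.eRk (X : Set α) ≤ 3) with h𝒟
  have hD : {X : Set α | X ⊆ M.E ∧ X.ncard = 4 ∧ M.eRk X ≤ 3}.ncard = 𝒟.card :=
    ncard_family_eq_card_filter M 4 (fun X => M.eRk X ≤ 3)
  rw [hD, ← hcardE']
  have key := Finset.sum_card_bipartiteAbove_eq_sum_card_bipartiteBelow (s := E') (t := 𝒟)
    (fun (e : α) (X : Finset α) => e ∉ X)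
  have hR : ∀ X ∈ 𝒟, (E'.bipartiteBelow (fun (e : α) (X : Finset α) => e ∉ X) X).card = E'.card - 4 := by
    intro X hX𝒟
    rw [h𝒟, Finset.mem_filter, Finset.mem_powersetCard] at hX𝒟
    have : E'.bipartiteBelow (fun (e : α) (X : Finset α) => e ∉ X) X = E' \ X := by
      ext e
      rw [Finset.mem_bipartiteBelow, Finset.mem_sdiff]
    rw [this, Finset.card_sdiff_of_subset hX𝒟.1.1, hX𝒟.1.2]
  have hL : ∀ e ∈ E', (𝒟.bipartiteAbove (fun (e : α) (X : Finset α) => e ∉ X) e).card ≤ B := by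
    intro e heE'
    have heE : e ∈ M.E := (hmemE' e).1 heE'
    have hfam : (𝒟.bipartiteAbove (fun (e : α) (X : Finset α) => e ∉ X) e).card =
        {X : Set α | X ⊆ M.E ∧ X.ncard = 4 ∧ (M.eRk X ≤ 3 ∧ e ∉ X)}.ncard := by
      rw [ncard_family_eq_card_filter M 4 (fun X => M.eRk X ≤ 3 ∧ e ∉ X)]
      congr 1
      ext X
      rw [Finset.mem_bipartiteAbove, h𝒟, Finset.mem_filter, Finset.mem_filter, Finset.mem_coe]
      tauto
    rw [hfam]
    have hsub : {X : Set α | X ⊆ M.E ∧ X.ncard = 4 ∧ (M.eRk X ≤ 3 ∧ e ∉ X)} ⊆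
        {X : Set α | X ⊆ M.E \ {e} ∧ X.ncard = 4 ∧ M.eRk X ≤ 3} := by
      rintro X ⟨hXE, hX4, hXr, heX⟩
      refine ⟨fun x hx => ⟨hXE hx, fun hxe => heX ?_⟩, hX4, hXr⟩
      rw [mem_singleton_iff.mp hxe] at hx
      exact hx
    exact (Set.ncard_le_ncard hsub (hEfin.finite_subsets.subset (fun X hX => hX.1.trans sdiff_subset))).trans
      (hB e heE)
  have hsumR : ∑ X ∈ 𝒟, (E'.bipartiteBelow (fun (e : α) (X : Finset α) => e ∉ X) X).card =
      𝒟.card * (E'.card - 4) := by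
    rw [Finset.sum_congr rfl hR, Finset.sum_const, smul_eq_mul]
  have hsumL : ∑ e ∈ E', (𝒟.bipartiteAbove (fun (e : α) (X : Finset α) => e ∉ X) e).card ≤ E'.card * B := by
    calc ∑ e ∈ E', (𝒟.bipartiteAbove (fun (e : α) (X : Finset α) => e ∉ X) e).card
        ≤ ∑ _e ∈ E', B := Finset.sum_le_sum hL
      _ = E'.card * B := by rw [Finset.sum_const, smul_eq_mul]
  rw [key, hsumR] at hsumL
  rw [mul_comm]
  exact hsumL

end S1CFG

end PercRepro
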